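import Summits.Ventures.CertifiedManyBodySolver.Downfold.BoxesHg1201ELadderUCellsP10
import HarnessLib

/-!
# The U-direction ladder of Hg-1201, part 14: `U`-CELL CHAINS OF ANY LENGTH (leaf-side list fold) and the M19 COLUMN READ CELL BY CELL

Venture CertifiedManyBodySolver, cell `pub/hubbard-downfold` (MO-S1 → S2 seam; D-0154 (1)(C) COVERAGE (ii) HgBa₂CuO₄₊δ «Hg-1201»), seat `hubbard-cov-hg1201-unc-1`
(lane U MEMBERS + QUOTIENT + OBJECT M; rulings R-ma / R-mb (b) / R-mc (a)(b) / R-me (a)); namespace `Summit.Ventures.CertifiedManyBodySolver.Downfold`. Parts 1–13 of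
this lane: `BoxesHg1201ULadder` (p607319) … `BoxesHg1201ELadderUCells` (part 12, p624835: generic 2/3/4-cell glue, M19b per-cell readings), `BoxesHg1201ELadderUCellsP10`
(part 13, p625246: the @10 twin). Numbers: `router/BOXES/HgBa2CuO4.md` §OF-RECORD v1.14; column M19 (optimal `p = 0.16`, @0) = `boxHg1201E_M19` = `U/t_eff ∈ [7/2, 44/5] ×
t′/t_eff ∈ [−27/50, −43/100] × n ∈ [4/5, 22/25] × t_eff ∈ [1/2, 3/5]` eV; its rung leaf «MOS2-hg1201-M19» is `Hg1201M19_StiffnessBoxCeiling` (bar′ `5084577/10⁷ = 0.98 × 0.5188344`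
rounded down); its residual corner PATCH is `t′ ∈ [−27/50, −13/25] × U × n ∈ [67/80, 22/25]` (box-2 `hg1201M19_cell_of_cornerPatch`, n-cut `67/80`).

THE OBJECT (HANDOFF § g7 (m)(n) of this base). (I) The captain's word obs STATUS l.2727 (a) asked for a `k`-cell left-edge closer «breakpoints as parameters, or a list
fold»; part 12 typed `k = 2, 3, 4` on the LEAF side (box-1 owns the ITEM side, `covHg1201M19b_PatchLeftEdge_of_chain`, obs l.2796). §C1 here is the LIST FOLD on the leaf
side: breakpoints `b 0, b 1, …, b (k+1)` (ℕ-indexed, no order hypothesis), one certified constant `c i` per cell, ANY `t′`-set `S` and `n`-set `N` ⇒ the strip shape on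
`[b 0, b (k+1)]`; a COVER-GENERIC leaf closer (any column, any future cover lemma — e.g. the narrower strips of the captain's TP-KINCUT ruling obs l.2793, `t* = −53/100` @0 /
`t*′ = −12/25` @10, once box-2 types their covers) and the three instances on today's strips/patch of record (M19b, M19, @10); plus the OVERLAP glue for transported cells
`[a, b₁] ∪ [a₂, b]`, `a₂ ≤ b₁`. (II) §C2–§C5 = the M19 COLUMN READ CELL BY CELL (twin of part 12 §G3–§G5, which did M19b): per-cell slice ceilings on
`boxHg1201E_M19.withEntry U [lo, hi]` from a CELL WORD (generic) / from the corner PATCH, slice glue, two slices ⇒ the twin leaf; the generic M19 rung reading and the exact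
full-`t_eff` reach; the LEVEL-1 readings `[7/2, 17/4] · [17/4, 5] · [5, 7] · [7, 44/5]` cell by cell (the ladder census is part 12 §G4 VERBATIM — M19 and M19b share the rows
`U/t [7/2, 44/5]` and `t_eff [1/2, 3/5]`; only `n` differs); all four ⇒ every M19 rung (part 10's `hg1201E_ladderM19_stiffness_of_rungLeaf`). WHY NOW: the M19 tops A′7o2 /
A′5 / A′44o5 (kit j305091/3/4) print ≈ 12:40Z+, then the captain's D1′ and the PEN's M19 route; whichever zone D1′ lands in, the cell / bank readings are then read BY NAME.

Everything here is PROVED (no `sorry`, no new axiom). HONEST FRAMING: every stiffness statement is a one-sided CEILING (CONTROL/CALIBRATION, wording class (xx1)),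
CONDITIONAL on strip / patch / cell hypotheses that do NOT exist at this writing; cell chains, breakpoints and legs are the captain's / PEN's instrument, not proposed
here; item and stub files of stmt-Ventures-26186/26187 are box-1's (captain RULING obs l.2729), untouched; typing certifies containment arithmetic of SCREENING-GRADE /
[float] members typed verbatim in parts 1/5 — nothing about HgBa₂CuO₄₊δ; no row / hull / bar / word of record is touched; no `T_c`, phase or `dT_c/dP` sentence; no summit
statement is proved by this file.
-/

noncomputable section

namespace Summit.Ventures.CertifiedManyBodySolver.Downfold

open Set NonemptyInterval
open Summit.Ventures.CertifiedManyBodySolver.Observables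
open Literature.MathematicalPhysics.QuantumLattice

/-! ## §C1 `U`-cell chains of any length (leaf-side list fold), the cover-generic leaf closer, the overlap glue -/

/-- **CHAIN OF `k+1` `U`-CELLS** (ℕ-indexed breakpoints `b 0, …, b (k+1)`, one certified constant `c i` on the cell `[b i, b (i+1)]`, `i ≤ k`; ANY `t′`-set `S`, ANY
`n`-set `N`; no order hypothesis on `b`): the strip shape holds on `U ∈ [b 0, b (k+1)]` with any common constant `c' ≥ c i`. Part 12's `obsStiffnessStrip_glueU{,3,4}` are
`k = 1, 2, 3`. [cite: Neumaier2004CompleteSearch, §11] -/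
theorem obsStiffnessStrip_chainU {S N : Set ℝ} (b : ℕ → ℝ) (c : ℕ → ℚ) {c' : ℚ} :
    ∀ k : ℕ, (∀ i ≤ k, c i ≤ c') →
      (∀ i ≤ k, ∀ tp ∈ S, ∀ U ∈ Icc (b i) (b (i + 1)), ∀ n ∈ N, ObsStiffnessSeqCeilingAt tp U n (c i)) →
      ∀ tp ∈ S, ∀ U ∈ Icc (b 0) (b (k + 1)), ∀ n ∈ N, ObsStiffnessSeqCeilingAt tp U n c'
  | 0, hc, h => obsStiffnessStrip_monoU (hc 0 le_rfl) le_rfl le_rfl (h 0 le_rfl)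
  | k + 1, hc, h =>
    obsStiffnessStrip_glueU le_rfl (hc (k + 1) le_rfl)
      (obsStiffnessStrip_chainU b c k (fun i hi => hc i (Nat.le_succ_of_le hi)) (fun i hi => h i (Nat.le_succ_of_le hi))) (h (k + 1) le_rfl)

/-- **OVERLAP GLUE** (transported cells may overlap): certificates on `U ∈ [a, b₁]` and on `U ∈ [a₂, b]` with `a₂ ≤ b₁` give one on `U ∈ [a, b]`
(restrict the second to `[b₁, b]`, then glue at `b₁`). [cite: Neumaier2004CompleteSearch, §11] -/
theorem obsStiffnessStrip_glueU_overlap {S N : Set ℝ} {a b₁ a₂ b : ℝ} {c₁ c₂ c : ℚ} (h₁c : c₁ ≤ c) (h₂c : c₂ ≤ c) (hov : a₂ ≤ b₁)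
    (h₁ : ∀ tp ∈ S, ∀ U ∈ Icc a b₁, ∀ n ∈ N, ObsStiffnessSeqCeilingAt tp U n c₁)
    (h₂ : ∀ tp ∈ S, ∀ U ∈ Icc a₂ b, ∀ n ∈ N, ObsStiffnessSeqCeilingAt tp U n c₂) :
    ∀ tp ∈ S, ∀ U ∈ Icc a b, ∀ n ∈ N, ObsStiffnessSeqCeilingAt tp U n c :=
  obsStiffnessStrip_glueU h₁c h₂c h₁ (obsStiffnessStrip_monoU (le_refl c₂) hov le_rfl h₂)

/-- **COVER-GENERIC LEAF CLOSER FROM A CELL CHAIN**: for ANY column whose leaf `L` is closed by «one constant `≤ bar` on the strip `S × [a, z] × N`» (the `cover`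
hypothesis — today box-2's `Hg1201M19b_StiffnessBoxCeiling_of_cornerStrip`, `Hg1201M19_…_of_cornerPatch`, `Hg1201M19P10_…_of_cornerStrip`; tomorrow their TP-KINCUT
twins), a chain of `k+1` cells from `b 0 = a` to `b (k+1) = z`, each with its own `c i ≤ bar`, closes `L`. [cite: Neumaier2004CompleteSearch, §11] -/
theorem stiffnessLeaf_of_cellChain {S N : Set ℝ} {a z : ℝ} {bar : ℚ} {L : Prop}
    (cover : ∀ c : ℚ, c ≤ bar → (∀ tp ∈ S, ∀ U ∈ Icc a z, ∀ n ∈ N, ObsStiffnessSeqCeilingAt tp U n c) → L)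
    (b : ℕ → ℝ) (c : ℕ → ℚ) (k : ℕ) (hb0 : b 0 = a) (hbk : b (k + 1) = z) (hc : ∀ i ≤ k, c i ≤ bar)
    (h : ∀ i ≤ k, ∀ tp ∈ S, ∀ U ∈ Icc (b i) (b (i + 1)), ∀ n ∈ N, ObsStiffnessSeqCeilingAt tp U n (c i)) : L := by
  have hchain := obsStiffnessStrip_chainU b c k hc h
  rw [hb0, hbk] at hchain
  exact cover bar le_rfl hchain

/-- **@0 M19b LEAF FROM A CHAIN OF `k+1` `U`-CELLS** on the strip of record `[−27/50, −13/25] × U × [179/200, 183/200]` (`b 0 = 7/2`, `b (k+1) = 44/5`, each cell its own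
`c i ≤ 0.5166800`); part 12's two/three/four-cell closers and `…_of_level1Strips` are `k = 1, 2, 3`. CONDITIONAL. [cite: ScalapinoWhiteZhang1993, §II] -/
theorem Hg1201M19b_StiffnessBoxCeiling_of_cellChain (b : ℕ → ℝ) (c : ℕ → ℚ) (k : ℕ) (hb0 : b 0 = 7 / 2) (hbk : b (k + 1) = 44 / 5)
    (hc : ∀ i ≤ k, c i ≤ 5166800 / 10000000)
    (h : ∀ i ≤ k, ∀ tp ∈ Icc (-27 / 50 : ℝ) (-13 / 25), ∀ U ∈ Icc (b i) (b (i + 1)), ∀ n ∈ Icc (179 / 200 : ℝ) (183 / 200),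
      ObsStiffnessSeqCeilingAt tp U n (c i)) :
    Hg1201M19b_StiffnessBoxCeiling :=
  stiffnessLeaf_of_cellChain (fun _ hc' h' => Hg1201M19b_StiffnessBoxCeiling_of_cornerStrip hc' h') b c k hb0 hbk hc h

/-- **@0 M19 LEAF FROM A CHAIN OF `k+1` `U`-CELLS** on the patch of record `[−27/50, −13/25] × U × [67/80, 22/25]` (`b 0 = 7/2`, `b (k+1) = 44/5`, each cell its own
`c i ≤ 0.5084577`). CONDITIONAL. [cite: ScalapinoWhiteZhang1993, §II] -/
theorem Hg1201M19_StiffnessBoxCeiling_of_cellChain (b : ℕ → ℝ) (c : ℕ → ℚ) (k : ℕ) (hb0 : b 0 = 7 / 2) (hbk : b (k + 1) = 44 / 5)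
    (hc : ∀ i ≤ k, c i ≤ 5084577 / 10000000)
    (h : ∀ i ≤ k, ∀ tp ∈ Icc (-27 / 50 : ℝ) (-13 / 25), ∀ U ∈ Icc (b i) (b (i + 1)), ∀ n ∈ Icc (67 / 80 : ℝ) (22 / 25),
      ObsStiffnessSeqCeilingAt tp U n (c i)) :
    Hg1201M19_StiffnessBoxCeiling :=
  stiffnessLeaf_of_cellChain (fun _ hc' h' => Hg1201M19_StiffnessBoxCeiling_of_cornerPatch hc' h') b c k hb0 hbk hc h

/-- **@10 M19P10 LEAF FROM A CHAIN OF `k+1` `U`-CELLS** on the strip of record `[−49/100, −47/100] × U × [43/50, 22/25]` (`b 0 = 3`, `b (k+1) = 17/2`, each cell its own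
`c i ≤ 0.4767609`); part 12's `Hg1201M19P10_StiffnessBoxCeiling_of_cellStrips` are `k = 1, 2`. CONDITIONAL. [cite: ScalapinoWhiteZhang1993, §II] -/
theorem Hg1201M19P10_StiffnessBoxCeiling_of_cellChain (b : ℕ → ℝ) (c : ℕ → ℚ) (k : ℕ) (hb0 : b 0 = 3) (hbk : b (k + 1) = 17 / 2)
    (hc : ∀ i ≤ k, c i ≤ 4767609 / 10000000)
    (h : ∀ i ≤ k, ∀ tp ∈ Icc (-49 / 100 : ℝ) (-47 / 100), ∀ U ∈ Icc (b i) (b (i + 1)), ∀ n ∈ Icc (43 / 50 : ℝ) (22 / 25),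
      ObsStiffnessSeqCeilingAt tp U n (c i)) :
    Hg1201M19P10_StiffnessBoxCeiling :=
  stiffnessLeaf_of_cellChain (fun _ hc' h' => Hg1201M19P10_StiffnessBoxCeiling_of_cornerStrip hc' h') b c k hb0 hbk hc h

/-- **INSTANTIATION PATTERN** (numbers only; the captain's LEVEL-1 breakpoints as an ℕ-indexed chain via `List.getD`, `k = 3`): with
`b i = [7/2, 17/4, 5, 7, 44/5].getD i (44/5)` one has `b 0 = 7/2`, `b (3+1) = 44/5` and the cells `[b i, b (i+1)]`, `i ≤ 3`, are `[7/2, 17/4] · [17/4, 5] · [5, 7] · [7, 44/5]`;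
feeding `Hg1201M19b_StiffnessBoxCeiling_of_cellChain b (fun i => [c₁, c₂, c₃, c₄].getD i c₄) 3 (by simp) (by simp)` and discharging the two `∀ i ≤ 3` by `interval_cases i <;> simpa
[using hᵢ]` re-derives part 12's `Hg1201M19b_StiffnessBoxCeiling_of_level1Strips` (checked in draft; not re-landed — same statement). [folklore] -/
theorem hg1201_level1_chain_breakpoints :
    (fun i : ℕ => ([7 / 2, 17 / 4, 5, 7, 44 / 5] : List ℝ).getD i (44 / 5)) 0 = 7 / 2 ∧
    (fun i : ℕ => ([7 / 2, 17 / 4, 5, 7, 44 / 5] : List ℝ).getD i (44 / 5)) (3 + 1) = 44 / 5 ∧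
    ((fun i : ℕ => ([7 / 2, 17 / 4, 5, 7, 44 / 5] : List ℝ).getD i (44 / 5)) 1 = 17 / 4 ∧
      (fun i : ℕ => ([7 / 2, 17 / 4, 5, 7, 44 / 5] : List ℝ).getD i (44 / 5)) 2 = 5 ∧
      (fun i : ℕ => ([7 / 2, 17 / 4, 5, 7, 44 / 5] : List ℝ).getD i (44 / 5)) 3 = 7) := by
  refine ⟨?_, ?_, ?_, ?_, ?_⟩ <;> simp

/-- **A FIVE-CELL CHAIN BY THE LIST PATTERN** (breakpoints `m₁ … m₄` and constants free; the first length part 12 does not spell out; level 2 of a bisection schedule would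
be `k = 7` the same way). CONDITIONAL. [cite: ScalapinoWhiteZhang1993, §II] -/
theorem Hg1201M19b_StiffnessBoxCeiling_of_fiveCellStrips {m₁ m₂ m₃ m₄ : ℝ} {c₁ c₂ c₃ c₄ c₅ : ℚ} (hc₁ : c₁ ≤ 5166800 / 10000000)
    (hc₂ : c₂ ≤ 5166800 / 10000000) (hc₃ : c₃ ≤ 5166800 / 10000000) (hc₄ : c₄ ≤ 5166800 / 10000000) (hc₅ : c₅ ≤ 5166800 / 10000000)
    (h₁ : ∀ tp ∈ Icc (-27 / 50 : ℝ) (-13 / 25), ∀ U ∈ Icc (7 / 2 : ℝ) m₁, ∀ n ∈ Icc (179 / 200 : ℝ) (183 / 200), ObsStiffnessSeqCeilingAt tp U n c₁)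
    (h₂ : ∀ tp ∈ Icc (-27 / 50 : ℝ) (-13 / 25), ∀ U ∈ Icc m₁ m₂, ∀ n ∈ Icc (179 / 200 : ℝ) (183 / 200), ObsStiffnessSeqCeilingAt tp U n c₂)
    (h₃ : ∀ tp ∈ Icc (-27 / 50 : ℝ) (-13 / 25), ∀ U ∈ Icc m₂ m₃, ∀ n ∈ Icc (179 / 200 : ℝ) (183 / 200), ObsStiffnessSeqCeilingAt tp U n c₃)
    (h₄ : ∀ tp ∈ Icc (-27 / 50 : ℝ) (-13 / 25), ∀ U ∈ Icc m₃ m₄, ∀ n ∈ Icc (179 / 200 : ℝ) (183 / 200), ObsStiffnessSeqCeilingAt tp U n c₄)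
    (h₅ : ∀ tp ∈ Icc (-27 / 50 : ℝ) (-13 / 25), ∀ U ∈ Icc m₄ (44 / 5), ∀ n ∈ Icc (179 / 200 : ℝ) (183 / 200), ObsStiffnessSeqCeilingAt tp U n c₅) :
    Hg1201M19b_StiffnessBoxCeiling := by
  refine Hg1201M19b_StiffnessBoxCeiling_of_cellChain (fun i => ([7 / 2, m₁, m₂, m₃, m₄, 44 / 5] : List ℝ).getD i (44 / 5))
    (fun i => ([c₁, c₂, c₃, c₄, c₅] : List ℚ).getD i c₅) 4 (by simp) (by simp) ?_ ?_
  · intro i hi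
    interval_cases i <;> simpa
  · intro i hi
    interval_cases i
    · simpa using h₁
    · simpa using h₂
    · simpa using h₃
    · simpa using h₄
    · simpa using h₅

/-! ## §C2 M19 per-cell slice ceilings (from a CELL WORD, from the corner PATCH), slice glue, two slices ⇒ the twin leaf -/

/-- **A CELL WORD ON ONE `U`-CELL OF M19 ⇒ THE SLICE CEILING** on `boxHg1201E_M19.withEntry U [lo, hi]` (any `lo ≤ hi : ℚ`; the cell word = the conclusion shape of
every box-2 cover lemma: `t′ ∈ [−27/50, −43/100] × U ∈ [lo, hi] × n ∈ [4/5, 22/25]`, one `c ≤ bar`; unc-2's generic slice word). CONDITIONAL.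
[cite: ScalapinoWhiteZhang1993, §II] -/
theorem stiffnessBoxCeilingBelow_M19Ucell_of_cellWord {lo hi : ℚ} (hle : lo ≤ hi) {bar c : ℚ} (hc : c ≤ bar)
    (hW : ∀ tp ∈ Icc (-27 / 50 : ℝ) (-43 / 100), ∀ U ∈ Icc (lo : ℝ) hi, ∀ n ∈ Icc (4 / 5 : ℝ) (22 / 25), ObsStiffnessSeqCeilingAt tp U n c) :
    StiffnessBoxCeilingBelow (boxHg1201E_M19.withEntry .UOverT (Entry.ofEnds lo hi hle .screening)) bar :=
  stiffnessBoxCeilingBelow_of_holdsOn hc (boxHg1201E_M19_sliceU_stiffnessWord_of_cellLeaf hle hW)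

/-- **The M19b twin** (cell word `t′ ∈ [−27/50, −43/100] × U ∈ [lo, hi] × n ∈ [167/200, 183/200]` ⇒ slice ceiling on `boxHg1201E_M19b.withEntry U [lo, hi]`; part 12's
`…_of_cornerStrip` is the instance through box-2's strip cover). CONDITIONAL. [cite: ScalapinoWhiteZhang1993, §II] -/
theorem stiffnessBoxCeilingBelow_M19bUcell_of_cellWord {lo hi : ℚ} (hle : lo ≤ hi) {bar c : ℚ} (hc : c ≤ bar)
    (hW : ∀ tp ∈ Icc (-27 / 50 : ℝ) (-43 / 100), ∀ U ∈ Icc (lo : ℝ) hi, ∀ n ∈ Icc (167 / 200 : ℝ) (183 / 200), ObsStiffnessSeqCeilingAt tp U n c) :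
    StiffnessBoxCeilingBelow (boxHg1201E_M19b.withEntry .UOverT (Entry.ofEnds lo hi hle .screening)) bar :=
  stiffnessBoxCeilingBelow_of_holdsOn hc (boxHg1201E_M19b_sliceU_stiffnessWord_of_cellLeaf hle hW)

/-- **ONE CELL'S PATCH CERTIFICATE ⇒ THE M19 SLICE CEILING** on `boxHg1201E_M19.withEntry U [lo, hi]` (box-2's `U`-parametric patch cover `hg1201M19_cell_of_cornerPatch`,
patch `t′ ∈ [−27/50, −13/25] × n ∈ [67/80, 22/25]`, any `c ≤ 0.5084577`). The interim object when some M19 cells have landed and others not. CONDITIONAL.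
[cite: ScalapinoWhiteZhang1993, §II] [cite: HazraVermaRanderia2019, eqs. (2)-(6)] -/
theorem stiffnessBoxCeilingBelow_M19Ucell_of_cornerPatch {lo hi : ℚ} (hle : lo ≤ hi) {c : ℚ} (hc : c ≤ 5084577 / 10000000)
    (h : ∀ tp ∈ Icc (-27 / 50 : ℝ) (-13 / 25), ∀ U ∈ Icc (lo : ℝ) hi, ∀ n ∈ Icc (67 / 80 : ℝ) (22 / 25), ObsStiffnessSeqCeilingAt tp U n c) :
    StiffnessBoxCeilingBelow (boxHg1201E_M19.withEntry .UOverT (Entry.ofEnds lo hi hle .screening)) (5084577 / 10000000) :=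
  stiffnessBoxCeilingBelow_M19Ucell_of_cellWord hle le_rfl (hg1201M19_cell_of_cornerPatch hc h)

/-- **M19 SLICE GLUE** (generic word `W`): words on the slices `[a, m]` and `[m, b]` of M19 give the word on the slice `[a, b]`. [folklore] -/
theorem holdsOn_M19Uslices_glue {W : (OneBandCoord → ℝ) → Prop} {a m b : ℚ} (ham : a ≤ m) (hmb : m ≤ b)
    (h₁ : HoldsOn W (boxHg1201E_M19.withEntry .UOverT (Entry.ofEnds a m ham .screening)))
    (h₂ : HoldsOn W (boxHg1201E_M19.withEntry .UOverT (Entry.ofEnds m b hmb .screening))) :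
    HoldsOn W (boxHg1201E_M19.withEntry .UOverT (Entry.ofEnds a b (ham.trans hmb) .screening)) := by
  intro p hp
  obtain ⟨⟨hU1, hU2⟩, hrest⟩ := (boxHg1201E_M19_sliceU_mem_iff _ p).1 hp
  rcases le_total (p .UOverT) ((m : ℚ) : ℝ) with hm | hm
  · exact h₁ p ((boxHg1201E_M19_sliceU_mem_iff ham p).2 ⟨⟨hU1, hm⟩, hrest⟩)
  · exact h₂ p ((boxHg1201E_M19_sliceU_mem_iff hmb p).2 ⟨⟨hm, hU2⟩, hrest⟩)

/-- **M19 SLICE CEILINGS GLUE** (each slice its own constant below the bar; the glued slice takes the larger). [cite: ScalapinoWhiteZhang1993, §II] -/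
theorem stiffnessBoxCeilingBelow_M19Uslices_glue {a m b bar : ℚ} (ham : a ≤ m) (hmb : m ≤ b)
    (h₁ : StiffnessBoxCeilingBelow (boxHg1201E_M19.withEntry .UOverT (Entry.ofEnds a m ham .screening)) bar)
    (h₂ : StiffnessBoxCeilingBelow (boxHg1201E_M19.withEntry .UOverT (Entry.ofEnds m b hmb .screening)) bar) :
    StiffnessBoxCeilingBelow (boxHg1201E_M19.withEntry .UOverT (Entry.ofEnds a b (ham.trans hmb) .screening)) bar := by
  obtain ⟨⟨c₁, hc₁, hW₁⟩, ⟨c₂, hc₂, hW₂⟩⟩ := And.intro h₁ h₂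
  exact ⟨max c₁ c₂, max_le hc₁ hc₂, holdsOn_M19Uslices_glue ham hmb (fun p hp => (hW₁ p hp).mono (le_max_left _ _))
    (fun p hp => (hW₂ p hp).mono (le_max_right _ _))⟩

/-- **M19 is (refines) its own full `U`-slice `[7/2, 44/5]`** (same entry re-inserted). [folklore] -/
theorem boxHg1201E_M19_refines_fullSliceU :
    boxHg1201E_M19.Refines (boxHg1201E_M19.withEntry .UOverT (Entry.ofEnds (7 / 2) (44 / 5) (by norm_num) .screening)) :=
  fun _ hp => Box.mem_withEntry_of_mem hp (hp .UOverT hg1201E_M19_U rfl)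

/-- **M19b is (refines) its own full `U`-slice `[7/2, 44/5]`.** [folklore] -/
theorem boxHg1201E_M19b_refines_fullSliceU :
    boxHg1201E_M19b.Refines (boxHg1201E_M19b.withEntry .UOverT (Entry.ofEnds (7 / 2) (44 / 5) (by norm_num) .screening)) :=
  fun _ hp => Box.mem_withEntry_of_mem hp (hp .UOverT hg1201E_M19b_U rfl)

/-- **THE TWIN LEAF «MOS2-hg1201-M19» FROM TWO SLICE CEILINGS** `[7/2, m]` and `[m, 44/5]` at the bar (any split `m`; each slice may come from its own cell certificate via
`stiffnessBoxCeilingBelow_M19Ucell_of_cornerPatch` / `…_of_cellWord`). CONDITIONAL. [cite: ScalapinoWhiteZhang1993, §II] -/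
theorem Hg1201M19_StiffnessBoxCeiling_of_twoSliceCeilings {m : ℚ} (hlo : 7 / 2 ≤ m) (hhi : m ≤ 44 / 5)
    (h₁ : StiffnessBoxCeilingBelow (boxHg1201E_M19.withEntry .UOverT (Entry.ofEnds (7 / 2) m hlo .screening)) (5084577 / 10000000))
    (h₂ : StiffnessBoxCeilingBelow (boxHg1201E_M19.withEntry .UOverT (Entry.ofEnds m (44 / 5) hhi .screening)) (5084577 / 10000000)) :
    Hg1201M19_StiffnessBoxCeiling :=
  stiffnessBoxCeilingBelow_of_refines (stiffnessBoxCeilingBelow_M19Uslices_glue hlo hhi h₁ h₂) boxHg1201E_M19_refines_fullSliceU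

/-- **The M19b twin: «MOS2-hg1201-M19b» FROM TWO SLICE CEILINGS** `[7/2, m]` and `[m, 44/5]` at the bar `0.5166800` (part 12's slice glue + the full-slice refinement).
CONDITIONAL. [cite: ScalapinoWhiteZhang1993, §II] -/
theorem Hg1201M19b_StiffnessBoxCeiling_of_twoSliceCeilings {m : ℚ} (hlo : 7 / 2 ≤ m) (hhi : m ≤ 44 / 5)
    (h₁ : StiffnessBoxCeilingBelow (boxHg1201E_M19b.withEntry .UOverT (Entry.ofEnds (7 / 2) m hlo .screening)) (5166800 / 10000000))
    (h₂ : StiffnessBoxCeilingBelow (boxHg1201E_M19b.withEntry .UOverT (Entry.ofEnds m (44 / 5) hhi .screening)) (5166800 / 10000000)) :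
    Hg1201M19b_StiffnessBoxCeiling :=
  stiffnessBoxCeilingBelow_of_refines (stiffnessBoxCeilingBelow_M19bUslices_glue hlo hhi h₁ h₂) boxHg1201E_M19b_refines_fullSliceU

/-! ## §C3 The generic M19 rung reading and the exact full-`t_eff` reach -/

/-- **THE GENERIC M19 RUNG READING** (quotient form): a ceiling on the M19 cell `[lo, hi]` certifies ONE `c ≤ bar` at every object-E point with `lo ≤ U/t_eff ≤ hi` and
`t_eff ∈ [1/2, 3/5]`, `t′/t ∈ [−27/50, −43/100]`, `n ∈ [4/5, 22/25]` (M19's entries). CONDITIONAL on the slice ceiling. [cite: ScalapinoWhiteZhang1993, §II] -/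
theorem hg1201E_M19Ucell_rungs_of_ceiling {lo hi : ℚ} (hle : lo ≤ hi) {bar : ℚ}
    (h : StiffnessBoxCeilingBelow (boxHg1201E_M19.withEntry .UOverT (Entry.ofEnds lo hi hle .screening)) bar) :
    ∃ c : ℚ, c ≤ bar ∧ ∀ U t tp n : ℝ, ((lo : ℝ) ≤ U / t ∧ U / t ≤ hi) → hg1201E_M19_t.Mem t → hg1201E_M19_tp.Mem tp →
      hg1201E_M19_n.Mem n → ObsStiffnessSeqCeilingAt tp (U / t) n c := by
  obtain ⟨c, hc, hW⟩ := h
  exact ⟨c, hc, fun U t tp n hUt ht htp hn => stiffnessWord_apply_oneBandPointE hW (oneBandPointE_mem_M19_sliceU hle hUt htp hn ht)⟩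

/-- **THE GENERIC M19 RUNG READING** (eV form): the same at every `(U, t_eff)` with `lo·t_eff ≤ U ≤ hi·t_eff` — member `m` eV is covered on
`t_eff ∈ [m/hi, m/lo] ∩ [1/2, 3/5]`. CONDITIONAL. [cite: ScalapinoWhiteZhang1993, §II] -/
theorem hg1201E_M19Ucell_rungs_of_ceiling' {lo hi : ℚ} (hle : lo ≤ hi) {bar : ℚ}
    (h : StiffnessBoxCeilingBelow (boxHg1201E_M19.withEntry .UOverT (Entry.ofEnds lo hi hle .screening)) bar) :
    ∃ c : ℚ, c ≤ bar ∧ ∀ U t tp n : ℝ, ((lo : ℝ) * t ≤ U ∧ U ≤ hi * t) → hg1201E_M19_t.Mem t → hg1201E_M19_tp.Mem tp →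
      hg1201E_M19_n.Mem n → ObsStiffnessSeqCeilingAt tp (U / t) n c := by
  obtain ⟨c, hc, hW⟩ := hg1201E_M19Ucell_rungs_of_ceiling hle h
  refine ⟨c, hc, fun U t tp n hU ht htp hn => hW U t tp n ?_ ht htp hn⟩
  have ht' := (Entry.mem_ofEnds_iff _ _ _ _ _).1 ht; push_cast at ht'
  have ht0 : (0 : ℝ) < t := by linarith [ht'.1]
  exact ⟨by rw [le_div_iff₀ ht0]; linarith [hU.1], by rw [div_le_iff₀ ht0]; linarith [hU.2]⟩

/-- **FULL-`t_eff` READING OF ONE M19 CELL**: a cell-`[lo, hi]` ceiling (`0 ≤ lo`) certifies every `U ∈ [3·lo/5, hi/2]` eV at EVERY `t_eff ∈ [1/2, 3/5]` over the M19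
`t′/t`, `n` entries (the reach is part 12's column-free `hg1201E_Ucell_Ureach_iff`). CONDITIONAL. [cite: ScalapinoWhiteZhang1993, §II] -/
theorem hg1201E_M19Ucell_fullReach_of_ceiling {lo hi : ℚ} (hle : lo ≤ hi) (hlo : 0 ≤ lo) {bar : ℚ}
    (h : StiffnessBoxCeilingBelow (boxHg1201E_M19.withEntry .UOverT (Entry.ofEnds lo hi hle .screening)) bar) :
    ∃ c : ℚ, c ≤ bar ∧ ∀ U t tp n : ℝ, ((3 : ℝ) / 5 * lo ≤ U ∧ U ≤ hi / 2) → hg1201E_M19_t.Mem t → hg1201E_M19_tp.Mem tp →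
      hg1201E_M19_n.Mem n → ObsStiffnessSeqCeilingAt tp (U / t) n c := by
  obtain ⟨c, hc, hW⟩ := hg1201E_M19Ucell_rungs_of_ceiling hle h
  refine ⟨c, hc, fun U t tp n hU ht htp hn => hW U t tp n ?_ ht htp hn⟩
  have ht' := (Entry.mem_ofEnds_iff _ _ _ _ _).1 ht
  push_cast at ht'
  exact (hg1201E_Ucell_Ureach_iff hlo).2 hU t ht'

/-! ## §C4 The LEVEL-1 readings on the M19 column, cell by cell (census = part 12 §G4 verbatim; CONDITIONAL on each cell's M19 slice ceiling) -/

/-- **M19 CELL `[5, 7]` ALONE** certifies ONE `c ≤ bar`: (i) at every `U ∈ [3, 7/2]` eV — in-house (D) `3.335` and Nilsson `3.42` — at EVERY `t_eff`; (ii) at each of the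
eight cut-at-7 members `m` (`hg1201U_level1_cut7`) on `t_eff ∈ [m/7, 3/5]`; (iii) at each part-11 straddler `m ∈ {2.865, 2.9462, 2.98}` on `t_eff ∈ [1/2, m/5]` (M19
`t′/t`, `n` entries). CONDITIONAL on the `[5, 7]` M19 slice ceiling. [cite: ScalapinoWhiteZhang1993, §II] -/
theorem hg1201E_M19_level1_cell57_rungs_of_ceiling {bar : ℚ}
    (h : StiffnessBoxCeilingBelow (boxHg1201E_M19.withEntry .UOverT (Entry.ofEnds 5 7 (by norm_num) .screening)) bar) :
    ∃ c : ℚ, c ≤ bar ∧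
      (∀ U t tp n : ℝ, ((3 : ℝ) ≤ U ∧ U ≤ 7 / 2) → hg1201E_M19_t.Mem t → hg1201E_M19_tp.Mem tp → hg1201E_M19_n.Mem n →
        ObsStiffnessSeqCeilingAt tp (U / t) n c) ∧
      (∀ m ∈ hg1201U_level1_cut7, ∀ t tp n : ℝ, ((m : ℝ) / 7 ≤ t ∧ t ≤ 3 / 5) → hg1201E_M19_tp.Mem tp → hg1201E_M19_n.Mem n →
        ObsStiffnessSeqCeilingAt tp ((m : ℝ) / t) n c) ∧
      (∀ m ∈ hg1201U_bank5_straddle, ∀ t tp n : ℝ, ((1 / 2 : ℝ) ≤ t ∧ t ≤ (m : ℝ) / 5) → hg1201E_M19_tp.Mem tp → hg1201E_M19_n.Mem n →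
        ObsStiffnessSeqCeilingAt tp ((m : ℝ) / t) n c) := by
  obtain ⟨c, hc, hW⟩ := hg1201E_M19Ucell_rungs_of_ceiling' _ h
  refine ⟨c, hc, fun U t tp n hU ht htp hn => hW U t tp n ?_ ht htp hn, fun m hm t tp n ht htp hn => ?_, fun m hm t tp n ht htp hn => ?_⟩
  · have ht' := (Entry.mem_ofEnds_iff _ _ _ _ _).1 ht
    push_cast at ht' ⊢
    constructor <;> linarith [ht'.1, ht'.2, hU.1, hU.2]
  · have hlo : ((7 / 2 : ℚ) : ℝ) < (m : ℝ) := (Rat.cast_lt (K := ℝ)).mpr (hg1201U_level1_cut7_window hm).1.1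
    push_cast at hlo
    have ht1 : (1 / 2 : ℝ) ≤ t := by linarith [ht.1]
    have htE : hg1201E_M19_t.Mem t := (Entry.mem_ofEnds_iff _ _ _ _ _).2 (by push_cast; exact ⟨ht1, ht.2⟩)
    refine hW _ t tp n ⟨?_, ?_⟩ htE htp hn
    · push_cast; linarith [ht.2]
    · push_cast; have := ht.1; rw [div_le_iff₀ (by norm_num : (0 : ℝ) < 7)] at this; linarith
  · have hhi : (m : ℝ) ≤ ((149 / 50 : ℚ) : ℝ) := (Rat.cast_le (K := ℝ)).mpr (hg1201U_straddle_mem_gap hm).1.2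
    push_cast at hhi
    have ht2 : t ≤ (3 / 5 : ℝ) := by linarith [ht.2]
    have htE : hg1201E_M19_t.Mem t := (Entry.mem_ofEnds_iff _ _ _ _ _).2 (by push_cast; exact ⟨ht.1, ht2⟩)
    refine hW _ t tp n ⟨?_, ?_⟩ htE htp hn
    · push_cast; have := ht.2; rw [le_div_iff₀ (by norm_num : (0 : ℝ) < 5)] at this; linarith
    · push_cast; linarith [ht.1]

/-- **M19 CELL `[7, 44/5]` ALONE** certifies ONE `c ≤ bar`: (i) at every `U ∈ [21/5, 22/5]` eV — cGW `4.37` — at EVERY `t_eff`; (ii) at each cut-at-7 member `m` on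
`t_eff ∈ [1/2, m/7]`; (iii) at the mRPA@QSGW rung `5.2` on the sliver `t_eff ∈ [13/22, 3/5]`. CONDITIONAL on the `[7, 44/5]` M19 slice ceiling. [cite: ScalapinoWhiteZhang1993, §II] -/
theorem hg1201E_M19_level1_cell7top_rungs_of_ceiling {bar : ℚ}
    (h : StiffnessBoxCeilingBelow (boxHg1201E_M19.withEntry .UOverT (Entry.ofEnds 7 (44 / 5) (by norm_num) .screening)) bar) :
    ∃ c : ℚ, c ≤ bar ∧
      (∀ U t tp n : ℝ, ((21 / 5 : ℝ) ≤ U ∧ U ≤ 22 / 5) → hg1201E_M19_t.Mem t → hg1201E_M19_tp.Mem tp → hg1201E_M19_n.Mem n →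
        ObsStiffnessSeqCeilingAt tp (U / t) n c) ∧
      (∀ m ∈ hg1201U_level1_cut7, ∀ t tp n : ℝ, ((1 / 2 : ℝ) ≤ t ∧ t ≤ (m : ℝ) / 7) → hg1201E_M19_tp.Mem tp → hg1201E_M19_n.Mem n →
        ObsStiffnessSeqCeilingAt tp ((m : ℝ) / t) n c) ∧
      (∀ t tp n : ℝ, ((13 / 22 : ℝ) ≤ t ∧ t ≤ 3 / 5) → hg1201E_M19_tp.Mem tp → hg1201E_M19_n.Mem n →
        ObsStiffnessSeqCeilingAt tp ((hg1201U_sakakibara2017_mRPA_QSGW : ℝ) / t) n c) := by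
  obtain ⟨c, hc, hW⟩ := hg1201E_M19Ucell_rungs_of_ceiling' _ h
  refine ⟨c, hc, fun U t tp n hU ht htp hn => hW U t tp n ?_ ht htp hn, fun m hm t tp n ht htp hn => ?_, fun t tp n ht htp hn => ?_⟩
  · have ht' := (Entry.mem_ofEnds_iff _ _ _ _ _).1 ht
    push_cast at ht' ⊢
    constructor <;> linarith [ht'.1, ht'.2, hU.1, hU.2]
  · have hhi : (m : ℝ) < ((21 / 5 : ℚ) : ℝ) := (Rat.cast_lt (K := ℝ)).mpr (hg1201U_level1_cut7_window hm).1.2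
    push_cast at hhi
    have ht2 : t ≤ (3 / 5 : ℝ) := by linarith [ht.2]
    have htE : hg1201E_M19_t.Mem t := (Entry.mem_ofEnds_iff _ _ _ _ _).2 (by push_cast; exact ⟨ht.1, ht2⟩)
    refine hW _ t tp n ⟨?_, ?_⟩ htE htp hn
    · push_cast; have := ht.2; rw [le_div_iff₀ (by norm_num : (0 : ℝ) < 7)] at this; linarith
    · push_cast; linarith [ht.1]
  · have htE : hg1201E_M19_t.Mem t := (Entry.mem_ofEnds_iff _ _ _ _ _).2 (by push_cast; exact ⟨by linarith [ht.1], ht.2⟩)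
    refine hW _ t tp n ⟨?_, ?_⟩ htE htp hn <;> norm_num [hg1201U_sakakibara2017_mRPA_QSGW] <;> linarith [ht.1, ht.2]

/-- **M19 CELLS `[7/2, 17/4]` AND `[17/4, 5]` ALONE** (the bisected lower segment): the first certifies the Jang rung `2.15` on `t_eff ∈ [43/85, 3/5]` and every
`U ∈ [21/10, 17/8]` at every `t_eff`; the second certifies Jang on `t_eff ∈ [1/2, 43/85]` and each part-11 straddler `m` on `t_eff ∈ [m/5, 3/5]`. CONDITIONAL on the
respective M19 slice ceilings. [cite: ScalapinoWhiteZhang1993, §II] -/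
theorem hg1201E_M19_level1_lowCells_rungs_of_ceilings {bar₁ bar₂ : ℚ} :
    (StiffnessBoxCeilingBelow (boxHg1201E_M19.withEntry .UOverT (Entry.ofEnds (7 / 2) (17 / 4) (by norm_num) .screening)) bar₁ →
      ∃ c : ℚ, c ≤ bar₁ ∧
        (∀ t tp n : ℝ, ((43 / 85 : ℝ) ≤ t ∧ t ≤ 3 / 5) → hg1201E_M19_tp.Mem tp → hg1201E_M19_n.Mem n →
          ObsStiffnessSeqCeilingAt tp ((hg1201U_jang2016 : ℝ) / t) n c) ∧
        (∀ U t tp n : ℝ, ((21 / 10 : ℝ) ≤ U ∧ U ≤ 17 / 8) → hg1201E_M19_t.Mem t → hg1201E_M19_tp.Mem tp → hg1201E_M19_n.Mem n →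
          ObsStiffnessSeqCeilingAt tp (U / t) n c)) ∧
    (StiffnessBoxCeilingBelow (boxHg1201E_M19.withEntry .UOverT (Entry.ofEnds (17 / 4) 5 (by norm_num) .screening)) bar₂ →
      ∃ c : ℚ, c ≤ bar₂ ∧
        (∀ t tp n : ℝ, ((1 / 2 : ℝ) ≤ t ∧ t ≤ 43 / 85) → hg1201E_M19_tp.Mem tp → hg1201E_M19_n.Mem n →
          ObsStiffnessSeqCeilingAt tp ((hg1201U_jang2016 : ℝ) / t) n c) ∧
        (∀ m ∈ hg1201U_bank5_straddle, ∀ t tp n : ℝ, ((m : ℝ) / 5 ≤ t ∧ t ≤ 3 / 5) → hg1201E_M19_tp.Mem tp → hg1201E_M19_n.Mem n →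
          ObsStiffnessSeqCeilingAt tp ((m : ℝ) / t) n c)) := by
  refine ⟨fun h => ?_, fun h => ?_⟩
  · obtain ⟨c, hc, hW⟩ := hg1201E_M19Ucell_rungs_of_ceiling' _ h
    refine ⟨c, hc, fun t tp n ht htp hn => ?_, fun U t tp n hU ht htp hn => hW U t tp n ?_ ht htp hn⟩
    · have htE : hg1201E_M19_t.Mem t := (Entry.mem_ofEnds_iff _ _ _ _ _).2 (by push_cast; exact ⟨by linarith [ht.1], ht.2⟩)
      refine hW _ t tp n ⟨?_, ?_⟩ htE htp hn <;> norm_num [hg1201U_jang2016] <;> linarith [ht.1, ht.2]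
    · have ht' := (Entry.mem_ofEnds_iff _ _ _ _ _).1 ht
      push_cast at ht' ⊢
      constructor <;> linarith [ht'.1, ht'.2, hU.1, hU.2]
  · obtain ⟨c, hc, hW⟩ := hg1201E_M19Ucell_rungs_of_ceiling' _ h
    refine ⟨c, hc, fun t tp n ht htp hn => ?_, fun m hm t tp n ht htp hn => ?_⟩
    · have htE : hg1201E_M19_t.Mem t := (Entry.mem_ofEnds_iff _ _ _ _ _).2 (by push_cast; exact ⟨ht.1, by linarith [ht.2]⟩)
      refine hW _ t tp n ⟨?_, ?_⟩ htE htp hn <;> norm_num [hg1201U_jang2016] <;> linarith [ht.1, ht.2]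
    · have hlo : ((573 / 200 : ℚ) : ℝ) ≤ (m : ℝ) := (Rat.cast_le (K := ℝ)).mpr (hg1201U_straddle_mem_gap hm).1.1
      push_cast at hlo
      have ht1 : (1 / 2 : ℝ) ≤ t := by linarith [ht.1]
      have htE : hg1201E_M19_t.Mem t := (Entry.mem_ofEnds_iff _ _ _ _ _).2 (by push_cast; exact ⟨ht1, ht.2⟩)
      refine hW _ t tp n ⟨?_, ?_⟩ htE htp hn
      · push_cast; linarith [ht.2]
      · push_cast; have := ht.1; rw [div_le_iff₀ (by norm_num : (0 : ℝ) < 5)] at this; linarith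

/-! ## §C5 All four level-1 cells (or any four) ⇒ every M19 rung -/

/-- **FOUR M19 CELL PATCHES ⇒ EVERY M19 RUNG** (breakpoints `m₁ m₂ m₃` free; through part 12's `Hg1201M19_StiffnessBoxCeiling_of_cellPatches` and part 10's
`hg1201E_ladderM19_stiffness_of_rungLeaf`): ONE `c ≤ 0.5084577` at every v1.8 rung `U ∈ [2.15, 4.37] × t_eff ∈ [1/2, 3/5] × t′/t ∈ [−27/50, −43/100] × n ∈ [4/5, 22/25]`.
CONDITIONAL on the four patch certificates. [cite: ScalapinoWhiteZhang1993, §II] -/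
theorem hg1201E_ladderM19_allRungs_of_fourCellPatches {m₁ m₂ m₃ : ℝ} {c₁ c₂ c₃ c₄ : ℚ} (hc₁ : c₁ ≤ 5084577 / 10000000)
    (hc₂ : c₂ ≤ 5084577 / 10000000) (hc₃ : c₃ ≤ 5084577 / 10000000) (hc₄ : c₄ ≤ 5084577 / 10000000)
    (h₁ : ∀ tp ∈ Icc (-27 / 50 : ℝ) (-13 / 25), ∀ U ∈ Icc (7 / 2 : ℝ) m₁, ∀ n ∈ Icc (67 / 80 : ℝ) (22 / 25), ObsStiffnessSeqCeilingAt tp U n c₁)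
    (h₂ : ∀ tp ∈ Icc (-27 / 50 : ℝ) (-13 / 25), ∀ U ∈ Icc m₁ m₂, ∀ n ∈ Icc (67 / 80 : ℝ) (22 / 25), ObsStiffnessSeqCeilingAt tp U n c₂)
    (h₃ : ∀ tp ∈ Icc (-27 / 50 : ℝ) (-13 / 25), ∀ U ∈ Icc m₂ m₃, ∀ n ∈ Icc (67 / 80 : ℝ) (22 / 25), ObsStiffnessSeqCeilingAt tp U n c₃)
    (h₄ : ∀ tp ∈ Icc (-27 / 50 : ℝ) (-13 / 25), ∀ U ∈ Icc m₃ (44 / 5), ∀ n ∈ Icc (67 / 80 : ℝ) (22 / 25), ObsStiffnessSeqCeilingAt tp U n c₄) :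
    ∃ c : ℚ, c ≤ 5084577 / 10000000 ∧ ∀ U t tp n : ℝ, hg1201U_litHullV18.Mem U → hg1201E_M19_t.Mem t → hg1201E_M19_tp.Mem tp →
      hg1201E_M19_n.Mem n → ObsStiffnessSeqCeilingAt tp (U / t) n c :=
  hg1201E_ladderM19_stiffness_of_rungLeaf ((Hg1201M19_StiffnessBoxCeiling_of_cellPatches (m := 5) hc₁ hc₂ hc₃ hc₄).2 h₁ h₂ h₃ h₄)

/-- **THE LEVEL-1 CELLS BY NAME ON M19** (`17/4`, `5`, `7`) ⇒ every M19 rung. CONDITIONAL. [cite: ScalapinoWhiteZhang1993, §II] -/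
theorem hg1201E_ladderM19_allRungs_of_level1Patches {c₁ c₂ c₃ c₄ : ℚ} (hc₁ : c₁ ≤ 5084577 / 10000000)
    (hc₂ : c₂ ≤ 5084577 / 10000000) (hc₃ : c₃ ≤ 5084577 / 10000000) (hc₄ : c₄ ≤ 5084577 / 10000000)
    (h₁ : ∀ tp ∈ Icc (-27 / 50 : ℝ) (-13 / 25), ∀ U ∈ Icc (7 / 2 : ℝ) (17 / 4), ∀ n ∈ Icc (67 / 80 : ℝ) (22 / 25), ObsStiffnessSeqCeilingAt tp U n c₁)
    (h₂ : ∀ tp ∈ Icc (-27 / 50 : ℝ) (-13 / 25), ∀ U ∈ Icc (17 / 4 : ℝ) 5, ∀ n ∈ Icc (67 / 80 : ℝ) (22 / 25), ObsStiffnessSeqCeilingAt tp U n c₂)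
    (h₃ : ∀ tp ∈ Icc (-27 / 50 : ℝ) (-13 / 25), ∀ U ∈ Icc (5 : ℝ) 7, ∀ n ∈ Icc (67 / 80 : ℝ) (22 / 25), ObsStiffnessSeqCeilingAt tp U n c₃)
    (h₄ : ∀ tp ∈ Icc (-27 / 50 : ℝ) (-13 / 25), ∀ U ∈ Icc (7 : ℝ) (44 / 5), ∀ n ∈ Icc (67 / 80 : ℝ) (22 / 25), ObsStiffnessSeqCeilingAt tp U n c₄) :
    ∃ c : ℚ, c ≤ 5084577 / 10000000 ∧ ∀ U t tp n : ℝ, hg1201U_litHullV18.Mem U → hg1201E_M19_t.Mem t → hg1201E_M19_tp.Mem tp →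
      hg1201E_M19_n.Mem n → ObsStiffnessSeqCeilingAt tp (U / t) n c :=
  hg1201E_ladderM19_allRungs_of_fourCellPatches hc₁ hc₂ hc₃ hc₄ h₁ h₂ h₃ h₄

/-- **ANY CHAIN OF M19 CELLS ⇒ EVERY M19 RUNG** (the list-fold form of the same reading). CONDITIONAL. [cite: ScalapinoWhiteZhang1993, §II] -/
theorem hg1201E_ladderM19_allRungs_of_cellChain (b : ℕ → ℝ) (c : ℕ → ℚ) (k : ℕ) (hb0 : b 0 = 7 / 2) (hbk : b (k + 1) = 44 / 5)
    (hc : ∀ i ≤ k, c i ≤ 5084577 / 10000000)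
    (h : ∀ i ≤ k, ∀ tp ∈ Icc (-27 / 50 : ℝ) (-13 / 25), ∀ U ∈ Icc (b i) (b (i + 1)), ∀ n ∈ Icc (67 / 80 : ℝ) (22 / 25),
      ObsStiffnessSeqCeilingAt tp U n (c i)) :
    ∃ c : ℚ, c ≤ 5084577 / 10000000 ∧ ∀ U t tp n : ℝ, hg1201U_litHullV18.Mem U → hg1201E_M19_t.Mem t → hg1201E_M19_tp.Mem tp →
      hg1201E_M19_n.Mem n → ObsStiffnessSeqCeilingAt tp (U / t) n c :=
  hg1201E_ladderM19_stiffness_of_rungLeaf (Hg1201M19_StiffnessBoxCeiling_of_cellChain b c k hb0 hbk hc h)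

/-- **ANY CHAIN OF M19b CELLS ⇒ EVERY M19b RUNG** (list-fold form of part 12's `hg1201E_ladder_allRungs_of_level1Strips`, via part 7's `hg1201E_ladder_stiffness_of_rungLeaf`).
CONDITIONAL. [cite: ScalapinoWhiteZhang1993, §II] -/
theorem hg1201E_ladder_allRungs_of_cellChain (b : ℕ → ℝ) (c : ℕ → ℚ) (k : ℕ) (hb0 : b 0 = 7 / 2) (hbk : b (k + 1) = 44 / 5)
    (hc : ∀ i ≤ k, c i ≤ 5166800 / 10000000)
    (h : ∀ i ≤ k, ∀ tp ∈ Icc (-27 / 50 : ℝ) (-13 / 25), ∀ U ∈ Icc (b i) (b (i + 1)), ∀ n ∈ Icc (179 / 200 : ℝ) (183 / 200),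
      ObsStiffnessSeqCeilingAt tp U n (c i)) :
    ∃ c : ℚ, c ≤ 5166800 / 10000000 ∧ ∀ U t tp n : ℝ, hg1201U_litHullV18.Mem U → hg1201E_M19b_t.Mem t → hg1201E_M19b_tp.Mem tp →
      hg1201E_M19b_n.Mem n → ObsStiffnessSeqCeilingAt tp (U / t) n c :=
  hg1201E_ladder_stiffness_of_rungLeaf (Hg1201M19b_StiffnessBoxCeiling_of_cellChain b c k hb0 hbk hc h)

end Summit.Ventures.CertifiedManyBodySolver.Downfold

end
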